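import Literature.Topology.FourManifolds.FramedLinkTraceBoundaryAux
import Literature.Topology.FourManifolds.LinkSurgeryPresentationTrim
import Literature.Topology.FourManifolds.KnotTraceUniqueness
import Literature.Topology.FourManifolds.HandleAttachingMapsTransport
import HarnessLib

/-!
# The boundary of the trace of a framed link is the surgery on it (Kirby 1989, Ch. I §5)

Topic `Literature/Topology/FourManifolds`; roadmap item 2 of `RLinkSphere.lean` and the "boundary"
scope note of `DottedCircleDiagram.lean`.

**Theorem** (`FramedLink.IsTrace.isSurgery_boundary`; Kirby 1989, Ch. I §5: *"`N³ = ∂M_L` is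
obtained from `S³` by surgery on the framed link `L`"*, Ch. I Lemma 2.1; Gompf–Stipsicz 1999,
§5.3, Prop. 5.1.2).  If the compact smooth `4`-manifold with boundary `P` is the trace
`X_L = B⁴ ∪_L (2-handles)` of the framed link `L ⊂ S³` (`L.IsTrace P`, i.e. `P` is presented by
the dotted-circle-free Kirby diagram of `L`, `DottedCircleDiagram.Realization`), then for every
boundary datum `bP` of `P` the boundary `3`-manifold `bP.carrier` is the integral surgery on `L`
with its framings (`L.IsSurgery (𝓡 3) bP.carrier`, i.e. `IsIntegralSurgeryLink`).

Proof.
1. A realization of the diagram without dotted circles has an abstract carved ball `X₁` with NO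
   dual handles, so its carving embedding is a diffeomorphism `E : X₁ ≅ D⁴`
   (`DottedCircleDiagram.Realization.exists_carvedDiffeomorph`, `KnotTraceUniqueness.lean`);
   transporting the attaching maps `handle j : T → X₁` along it
   (`HandleAttachingMap.transport`, `IsMultiAttachment.transport`,
   `HandleAttachingMapsTransport.lean`) exhibits `P` as `D⁴` with `2`-handles attached along
   attaching maps whose boundary values are the framed tubes `incl (νⱼ (angle, fibre))`
   (`transport_handle_apply_of_depth_zero`, from the clause `carvedEmbed_handle`).
2. (`isSurgeryPresentation_boundary_of_isMultiAttachment`, file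
   `FramedLinkTraceBoundaryAux.lean`: Kirby's Lemma 2.1 for `n` handles.)  Hence `bP.carrier` is
   surgery on `L` *presented with the realization's tubes* `νⱼ`
   (`DottedCircleDiagram.Realization.isSurgeryPresentation_boundary`).
3. (`Link.IsSurgeryPresentation.isIntegralSurgeryLink_of_disjoint_unitTubes`, file
   `LinkSurgeryPresentationTrim.lean`.)  The realization pins `νⱼ` only on the open unit disc
   bundle, where the tubes are pairwise disjoint because the attaching maps are
   (`pairwise_disjoint_unitTube`); rescaling and trimming the tubes (same framings
   `L.framing j`, same presentation) produces the pairwise disjoint full tubes demanded by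
   `IsIntegralSurgeryLink`.
Everything here is proved; no named facts are introduced.

## References

* R. C. Kirby, *The Topology of 4-Manifolds*, LNM 1374 (1989), Ch. I §2 Lemma 2.1, §5. [Kirby1989]
* R. E. Gompf, A. I. Stipsicz, *4-Manifolds and Kirby Calculus* (1999), §5.3. [GompfStipsicz1999]
* A. A. Kosinski, *Differential Manifolds*, Academic Press (1993), VI §6. [Kosinski1993]
-/

open scoped Manifold ContDiff Topology
open Set Function Metric

noncomputable section

namespace Literature.Topology.FourManifolds

universe u v

/-- Local notation: `𝔼 n` is the model Euclidean space `EuclideanSpace ℝ (Fin n)`. -/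
local notation "𝔼 " n:arg => EuclideanSpace ℝ (Fin n)

/-- Local notation: `𝔻 n` is the closed unit ball in `EuclideanSpace ℝ (Fin n)`. -/
local notation "𝔻 " n:arg => (Metric.closedBall (0 : EuclideanSpace ℝ (Fin n)) 1)

set_option quotPrecheck false in
/-- Local notation: Kosinski's tube `T ⊆ D⁴` of the circle `S¹ × 0`, as a type. -/
local notation "𝕋" => ↥(handleTube 3 2)

set_option quotPrecheck false in
/-- Local notation: the inclusion `S³ ↪ D⁴` of the boundary datum of the 4-disc. -/
local notation "ι₃" => (closedBallBoundaryData 3).incl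

attribute [local instance] fact_finrank_euclideanSpace_succ

/-! ### §1 A trace realization is a multi-attachment over `D⁴` along the framed tubes -/

namespace DottedCircleDiagram.Realization

variable {κ : Type u} [Finite κ] {L : FramedLink κ} {P : Type v} [TopologicalSpace P]
  [ChartedSpace (EuclideanHalfSpace 4) P] (R : (ofFramedLink L).Realization P)

/-- **Boundary values of the transported attaching maps**: if `E : X₁ ≅ D⁴` is the carving
diffeomorphism (`E x = carvedEmbed x`), then on `T ∩ ∂D⁴` the attaching map `E ∘ handle j` is the
framed tube of the `j`-th component, `(angle, fibre) ↦ incl (νⱼ (angle, fibre))`.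
[cite: Kirby1989, Ch. I §2] -/
theorem transport_handle_apply_of_depth_zero (E : R.carved ≃ₘ⟮𝓡∂ 4, 𝓡∂ 4⟯ 𝔻 4)
    (hE : ∀ (x : R.carved) (hx : x ∈ HandleAttachingMap.coresComplement R.dual),
      E x = R.carvedEmbed ⟨x, hx⟩)
    (j : κ) (y : 𝕋) (hy : tubeDepth y = 0) :
    ((R.handle j).transport E).toFun y = ι₃ (R.tube j (tubeAngle y, tubeFibre y)) := by
  rw [HandleAttachingMap.transport_apply, hE _ (R.handle_mem j y)]
  exact R.carvedEmbed_handle j y hy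

/-- **The open unit tubes of the realization are pairwise disjoint**: `νᵢ (S¹ × D̊²)` and
`νⱼ (S¹ × D̊²)` are boundary values of the transported attaching maps `E ∘ handle i`,
`E ∘ handle j`, which have disjoint ranges. [folklore] -/
theorem pairwise_disjoint_unitTube :
    Pairwise fun i j => Disjoint (R.tube i '' (univ ×ˢ Metric.ball (0 : 𝔼 2) 1))
      (R.tube j '' (univ ×ˢ Metric.ball (0 : 𝔼 2) 1)) := by
  obtain ⟨E, hE⟩ := R.exists_carvedDiffeomorph
  have hdisj := HandleAttachingMap.pairwise_disjoint_range_transport R.disjoint_handle E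
  intro i j hij
  refine Set.disjoint_left.2 ?_
  rintro _ ⟨⟨x, w⟩, ⟨-, hw⟩, rfl⟩ ⟨⟨x', w'⟩, ⟨-, hw'⟩, h⟩
  rw [mem_ball_zero_iff] at hw hw'
  have hpos : 0 < 1 - 0 - ‖w‖ ^ 2 := by nlinarith [norm_nonneg w]
  have hpos' : 0 < 1 - 0 - ‖w'‖ ^ 2 := by nlinarith [norm_nonneg w']
  have hy : ((R.handle i).transport E).toFun (mkTubePt x w 0 le_rfl hpos) = ι₃ (R.tube i (x, w)) := by
    rw [R.transport_handle_apply_of_depth_zero E hE i _ (tubeDepth_mkTubePt _ _ _ _ _),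
      tubeAngle_mkTubePt, tubeFibre_mkTubePt]
  have hy' : ((R.handle j).transport E).toFun (mkTubePt x' w' 0 le_rfl hpos') =
      ι₃ (R.tube j (x', w')) := by
    rw [R.transport_handle_apply_of_depth_zero E hE j _ (tubeDepth_mkTubePt _ _ _ _ _),
      tubeAngle_mkTubePt, tubeFibre_mkTubePt]
  refine Set.disjoint_left.1 (hdisj hij) ⟨_, hy⟩ ⟨mkTubePt x' w' 0 le_rfl hpos', ?_⟩
  rw [hy']
  exact congrArg _ h

/-! ### §2 The boundary of the trace -/

/-- **The boundary of a trace is presented as surgery with the realization's tubes**: for every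
boundary datum `bP` of `P`, `bP.carrier` is surgery on `L` presented with the tubular
neighbourhoods `R.tube` (`Link.IsSurgeryPresentation`) — transport the attachment to `D⁴` along
the carving diffeomorphism and apply Kirby's Lemma 2.1 for `n` handles
(`isSurgeryPresentation_boundary_of_isMultiAttachment`). [cite: Kirby1989, Ch. I §5] -/
theorem isSurgeryPresentation_boundary [IsManifold (𝓡∂ 4) ∞ P] (bP : BoundaryData (𝓡∂ 4) P (𝓡 3)) :
    L.toLink.IsSurgeryPresentation (𝓡 3) bP.carrier R.tube := by
  obtain ⟨E, hE⟩ := R.exists_carvedDiffeomorph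
  exact isSurgeryPresentation_boundary_of_isMultiAttachment (fun j => (R.handle j).transport E)
    R.tube (R.transport_handle_apply_of_depth_zero E hE) (R.isMultiAttachment_handle.transport E) bP

include R in
/-- **The boundary of a trace is the integral surgery on the framed link** (realization form):
the presentation with the realization's tubes, whose open unit tubes are pairwise disjoint and
which realise the framings `L.framing j`, is upgraded to `IsIntegralSurgeryLink` by rescaling and
trimming the tubes. [cite: Kirby1989, Ch. I §5] -/
theorem isSurgery_boundary [IsManifold (𝓡∂ 4) ∞ P] (bP : BoundaryData (𝓡∂ 4) P (𝓡 3)) :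
    L.IsSurgery (𝓡 3) bP.carrier :=
  (R.isSurgeryPresentation_boundary bP).isIntegralSurgeryLink_of_disjoint_unitTubes
    R.hasFraming_tube R.pairwise_disjoint_unitTube

end DottedCircleDiagram.Realization

/-- **The boundary of the trace of a framed link is the surgery on it** (Kirby 1989, Ch. I §5:
`N³ = ∂M_L` is obtained from `S³` by surgery on `L`; Gompf–Stipsicz 1999, §5.3): if `P` is the
trace `X_L = B⁴ ∪_L (2-handles)` of `L` then for every boundary datum `bP` of `P` the boundary
`3`-manifold `bP.carrier` is integral surgery on `L` with its framings,
`L.IsSurgery (𝓡 3) bP.carrier`. [cite: Kirby1989, Ch. I §5] -/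
theorem FramedLink.IsTrace.isSurgery_boundary {ι : Type u} [Finite ι] {L : FramedLink ι}
    {P : Type v} [TopologicalSpace P] [ChartedSpace (EuclideanHalfSpace 4) P]
    [IsManifold (𝓡∂ 4) ∞ P] (h : L.IsTrace P) (bP : BoundaryData (𝓡∂ 4) P (𝓡 3)) :
    L.IsSurgery (𝓡 3) bP.carrier := by
  obtain ⟨R⟩ := h
  exact R.isSurgery_boundary bP

end Literature.Topology.FourManifolds
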